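import Summits.NavierStokesRegularity.NavierStokesRegularity.Theorems.StrainDoorsDSSRecordLaws
import Summits.NavierStokesRegularity.NavierStokesRegularity.Theorems.StrainDoorsDSSVelocityRecord
import Literature.Analysis.FluidPDE.ChaeWolfRemovingDSSHolds
import HarnessLib

/-!
# StrainDoorsDSSThreeNumbers — THE THREE NUMBERS OF A CHAE–WOLF DSS SINGULARITY

nsreg-p1 g35, ROUND-55 (helper lane of `stmt-NavierStokesRegularity-0056`, rung N0; lands after ROUND-53 PART 3
`StrainDoorsDSSRecordLaws` and ROUND-54 PART B `StrainDoorsDSSVelocityRecord`).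

ROUNDS 52–54 priced the records of the three scale-invariant one-point numbers of a singularity at time `0` —
the strain number `N = (0 − t)λ₁`, the vorticity number `W = (0 − t)|ω|` and the velocity number
`V² = (0 − t)|u|²` — and showed that on a `c`-discretely self-similar solution (`c > 1`) each number is ATTAINED,
so that its record law holds with no record hypothesis, PROVIDED the relevant field decays at spatial infinity on
one period: the VELOCITY for `V` (which Chae–Wolf's Theorem 1.1 supplies — and the tree now PROVES that theorem:
`chaeWolf2017_dss_typeI_decay_holds`), the GRADIENT for `N` and `W` (which it does not).

This file closes the gap down to ONE local clause and assembles the trilogy.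

* §1–§2 ★★ `dss_typeIGrad_of_shell_bound` — **Chae–Wolf's covering argument for the gradient.**  For a `c`-DSS
  field jointly smooth on `t < 0`: if `∇u` stays bounded up to the singular time on ONE spatial shell,
  `sup {|∇u(t,x)| : −1 < t < 0, 1 ≤ |x| ≤ c} < ∞` (the gradient form of "`u` is regular on `Q̄ ∖ {(0,0)}`",
  the first clause of Chae–Wolf's Theorem 1.1, dropped by the tree's rendering; in print it is their estimate (3.6)
  with `l = 1`), then `|∇u(t,x)| ≤ C/(|x| + √(−t))²` for ALL `t < 0`, `x` — every space-time point is a scaled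
  copy of a point of the closed parabolic annulus `Q̄(0,c) ∖ Q(0,1)`, whose far-from-zero part is the shell and
  whose rest is compact (this is Step 5 of Chae–Wolf's proof of (1.5), run for `∇u` instead of `u`).
  `typeIGrad_of_sqForm` converts the printed shape `C₁/((−t) + |x|²)` of (3.6) into this one.
* §3 ★★ `chaeWolf_dss_velocity_record_law_holds` — ROUND-54's velocity record law and «`V* ≤ 2Π*`» with the
  Chae–Wolf hypothesis DISCHARGED BY NAME (`chaeWolf2017_dss_typeI_decay_holds`): every `c`-DSS classical solution
  (`ν = 1`) in `C((−∞,0); L^q)`, `q ≥ 3`, `u ≢ 0`, has a velocity record point with `|u| ≤ 2(0 − t)|∇p|` —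
  NO named-fact hypothesis left.
* §4 ★★ `chaeWolf_dss_three_numbers` — **THE THREE NUMBERS THEOREM.**  Same class, `ω ≢ 0`, plus the shell
  gradient bound: there are a strain record point `(t,x,e)` (`N* = (0 − t)q ≥ 1`, the strain record law
  `N + N² − (0 − t)²·Δ-credit ≤ (0 − t)²H`), a vorticity record point `(t_ω,x_ω)` (`1 + (0 − t_ω)|∇ξ|²_F ≤
  (0 − t_ω)q(ξ) ≤ N*`: the twist of the vortex lines at the vorticity record is paid by the strain record) and a
  velocity record point `(t_v,x_v)` (`|u|(1 + 2(0 − t_v)|∇û|²_F) ≤ 2(0 − t_v)(−û·∇p)`, `|u| ≤ 2(0 − t_v)|∇p|`).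
  `chaeWolf_dss_three_numbers_of_typeIGrad` takes instead the printed bound (3.6) `|∇u| ≤ C₁/((−t) + |x|²)`.

WHAT THIS IS NOT: `TypeIDSSLiouville` (Bradshaw–Tsai OP 5.1, general `c > 1`) stays OPEN — these are necessary
conditions every such solution meets; no profile is excluded; `0056`/NS regularity are not proved.  The shell
gradient bound is a HYPOTHESIS here (Chae–Wolf (3.6) is printed, not vendored).  No new definitions; no sorry.
[cite: ChaeWolf2017RemovingDSS, Theorem 1.1, proof of (1.5) Step 5 (arXiv:1610.09464 p. 7) and §3 estimate (3.6) (p. 8)]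
-/

noncomputable section

open MeasureTheory Set Function Filter Metric Real InnerProductSpace
open _root_.Topology
open scoped ENNReal NNReal RealInnerProductSpace ContDiff Laplacian
open Literature.Analysis Literature.Analysis.FluidPDE
open Literature.Analysis.FluidPDE.VorticityDirectionDynamics

set_option linter.dupNamespace false

namespace Summit.NavierStokesRegularity.NavierStokesRegularity.Theorems.StrainDoors

open Summit.NavierStokesRegularity.NavierStokesRegularity.Theorems.ArgmaxDoors

set_option maxSynthPendingDepth 3

/-! ## §1 DSS scaling of the gradient -/

/-- **DSS scaling of the gradient**: `∇u(t,x) = c²·∇u(c²t, cx)` for a `c`-DSS field. [folklore] -/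
theorem dss_fderiv_eq {c : ℝ} {u : ℝ → (EuclideanSpace ℝ (Fin 3)) → (EuclideanSpace ℝ (Fin 3))}
    (h : IsDiscretelySelfSimilar c u) (t : ℝ) (x : EuclideanSpace ℝ (Fin 3)) :
    fderiv ℝ (u t) x = c ^ 2 • fderiv ℝ (u (c ^ 2 * t)) (c • x) := by
  have key : u t = fun y => c • u (c ^ 2 * t) (c • y) := (congrFun h t).symm
  rw [key, fderiv_smul_comp_smul]

/-- Period transport of the gradient norm along the powers of the scaling factor:
`|∇u(t,x)| = (cⁿ)²·|∇u((cⁿ)²t, cⁿx)|`, `n ∈ ℤ`. [folklore] -/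
theorem dss_gradNorm_zpow {c : ℝ} (hc : c ≠ 0)
    {u : ℝ → (EuclideanSpace ℝ (Fin 3)) → (EuclideanSpace ℝ (Fin 3))}
    (h : IsDiscretelySelfSimilar c u) (n : ℤ) (t : ℝ) (x : EuclideanSpace ℝ (Fin 3)) :
    ‖fderiv ℝ (u t) x‖ = (c ^ n) ^ 2 * ‖fderiv ℝ (u ((c ^ n) ^ 2 * t)) ((c ^ n) • x)‖ := by
  rw [dss_fderiv_eq (h.zpow hc n) t x, norm_smul, Real.norm_of_nonneg (sq_nonneg _)]

/-! ## §2 The shell gradient bound ⇒ a global Type-I gradient bound -/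

/-- ★★ **CHAE–WOLF'S COVERING ARGUMENT FOR THE GRADIENT.**  A `c`-DSS field (`c > 1`) jointly smooth on `t < 0`
whose gradient stays bounded up to the singular time on the spatial shell `1 ≤ |x| ≤ c`
(`sup {|∇u(t,x)| : −1 < t < 0, 1 ≤ |x| ≤ c} < ∞`) obeys the global Type-I gradient bound
`|∇u(t,x)| ≤ C/(|x| + √(−t))²`, `t < 0`.  (Scale `(t,x)` by the power of `c` that puts `max(|x|, √(−t))` in
`[1,c)`; the image lies in the closed parabolic annulus `{−c² ≤ t < 0, |x| ≤ c} ∖ {−1 < t, |x| < 1}`, which is the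
shell plus a compact set inside `t ≤ −1`.) [cite: ChaeWolf2017RemovingDSS, proof of (1.5), Step 5 (arXiv:1610.09464 p. 7)] -/
theorem dss_typeIGrad_of_shell_bound {c : ℝ} (hc : 1 < c)
    {u : ℝ → (EuclideanSpace ℝ (Fin 3)) → (EuclideanSpace ℝ (Fin 3))}
    (hsm : IsSmoothSpaceTimeOn (Iio 0) u) (hdss : IsDiscretelySelfSimilar c u)
    (hshell : ∃ G : ℝ, ∀ t : ℝ, -1 < t → t < 0 → ∀ x : EuclideanSpace ℝ (Fin 3),
      1 ≤ ‖x‖ → ‖x‖ ≤ c → ‖fderiv ℝ (u t) x‖ ≤ G) :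
    ∃ C : ℝ, ∀ t : ℝ, t < 0 → ∀ x : EuclideanSpace ℝ (Fin 3),
      ‖fderiv ℝ (u t) x‖ ≤ C / (‖x‖ + Real.sqrt (0 - t)) ^ 2 := by
  have hc0 : 0 < c := one_pos.trans hc
  obtain ⟨G, hG⟩ := hshell
  -- the compact part of the annulus: `t ∈ [−c², −1]`, `|x| ≤ c`
  obtain ⟨K, hK⟩ : ∃ K : Set (ℝ × EuclideanSpace ℝ (Fin 3)),
      K = Icc (-(c ^ 2)) (-1) ×ˢ closedBall (0 : EuclideanSpace ℝ (Fin 3)) c := ⟨_, rfl⟩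
  have hKc : IsCompact K := by rw [hK]; exact isCompact_Icc.prod (isCompact_closedBall _ _)
  have hWc : ContinuousOn (fun z : ℝ × EuclideanSpace ℝ (Fin 3) => fderiv ℝ (u z.1) z.2) K := by
    refine (hsm.fderiv_slice (uniqueDiffOn_Iio 0)).continuousOn.mono fun z hz => mk_mem_prod ?_ (mem_univ _)
    rw [hK] at hz
    exact lt_of_le_of_lt (mem_prod.mp hz).1.2 (by norm_num)
  obtain ⟨G₁, hG₁⟩ := hKc.exists_bound_of_continuousOn hWc
  -- a common nonnegative bound on the whole closed annulus
  obtain ⟨Gb, hGb⟩ : ∃ Gb : ℝ, Gb = max 0 (max G G₁) := ⟨_, rfl⟩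
  have hGb0 : 0 ≤ Gb := by rw [hGb]; exact le_max_left _ _
  have hGle : G ≤ Gb := by rw [hGb]; exact (le_max_left _ _).trans (le_max_right _ _)
  have hG₁le : G₁ ≤ Gb := by rw [hGb]; exact (le_max_right _ _).trans (le_max_right _ _)
  have hann : ∀ t : ℝ, -(c ^ 2) ≤ t → t < 0 → ∀ x : EuclideanSpace ℝ (Fin 3), ‖x‖ ≤ c →
      (1 ≤ ‖x‖ ∨ t ≤ -1) → ‖fderiv ℝ (u t) x‖ ≤ Gb := by
    intro t ht1 ht0 x hxc hor
    by_cases ht : t ≤ -1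
    · have hz : (t, x) ∈ K := by
        rw [hK]; exact mk_mem_prod ⟨ht1, ht⟩ (mem_closedBall_zero_iff.mpr hxc)
      exact (hG₁ (t, x) hz).trans hG₁le
    · push Not at ht
      have hx1 : 1 ≤ ‖x‖ := hor.resolve_right (not_le.mpr ht)
      exact (hG t ht ht0 x hx1 hxc).trans hGle
  refine ⟨4 * c ^ 2 * Gb, fun t ht x => ?_⟩
  -- the parabolic size `M = max(|x|, √(−t))`, normalised into `[1, c)` by a power `k = c^m`
  have ht' : (0 : ℝ) < 0 - t := by linarith
  have hst : 0 < Real.sqrt (0 - t) := Real.sqrt_pos.mpr ht'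
  obtain ⟨M, hM⟩ : ∃ M : ℝ, M = max ‖x‖ (Real.sqrt (0 - t)) := ⟨_, rfl⟩
  have hxM : ‖x‖ ≤ M := by rw [hM]; exact le_max_left _ _
  have hsM : Real.sqrt (0 - t) ≤ M := by rw [hM]; exact le_max_right _ _
  have hM0 : 0 < M := hst.trans_le hsM
  obtain ⟨m, hm1, hm2⟩ := exists_mem_Ico_zpow hM0 hc
  obtain ⟨k, hk⟩ : ∃ k : ℝ, k = c ^ m := ⟨_, rfl⟩
  have hk0 : 0 < k := by rw [hk]; exact zpow_pos hc0 m
  have hkM : k ≤ M := by rw [hk]; exact hm1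
  have hMk : M < k * c := by rw [hk, ← zpow_add_one₀ hc0.ne']; exact hm2
  have hkinv : c ^ (-m) = k⁻¹ := by rw [zpow_neg, hk]
  -- the DSS transport to the rescaled point `((k⁻¹)² t, k⁻¹ x)`
  have hgrad : ‖fderiv ℝ (u t) x‖ =
      (k⁻¹) ^ 2 * ‖fderiv ℝ (u ((k⁻¹) ^ 2 * t)) (k⁻¹ • x)‖ := by
    have := dss_gradNorm_zpow hc0.ne' hdss (-m) t x
    rwa [hkinv] at this
  -- the rescaled point lies in the closed annulus
  have hxn : ‖k⁻¹ • x‖ = ‖x‖ / k := by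
    rw [norm_smul, norm_inv, Real.norm_of_nonneg hk0.le, inv_mul_eq_div]
  have h1 : ‖k⁻¹ • x‖ ≤ c := by
    rw [hxn, div_le_iff₀ hk0]
    nlinarith
  have hsq : (k⁻¹) ^ 2 * (0 - t) = (Real.sqrt (0 - t) / k) ^ 2 := by
    rw [div_pow, Real.sq_sqrt ht'.le]
    field_simp
  have hsk : Real.sqrt (0 - t) / k < c := by
    rw [div_lt_iff₀ hk0]; nlinarith
  have h2 : -(c ^ 2) ≤ (k⁻¹) ^ 2 * t := by
    have hlt : (Real.sqrt (0 - t) / k) ^ 2 < c ^ 2 :=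
      pow_lt_pow_left₀ hsk (div_nonneg hst.le hk0.le) two_ne_zero
    nlinarith [hsq, hlt]
  have h3 : (k⁻¹) ^ 2 * t < 0 := mul_neg_of_pos_of_neg (by positivity) ht
  have h4 : 1 ≤ ‖k⁻¹ • x‖ ∨ (k⁻¹) ^ 2 * t ≤ -1 := by
    rcases le_total (Real.sqrt (0 - t)) ‖x‖ with hle | hle
    · left
      have hMx : M = ‖x‖ := by rw [hM]; exact max_eq_left hle
      rw [hxn, le_div_iff₀ hk0, one_mul, ← hMx]
      exact hkM
    · right
      have hMs : M = Real.sqrt (0 - t) := by rw [hM]; exact max_eq_right hle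
      have hge : 1 ≤ Real.sqrt (0 - t) / k := by
        rw [le_div_iff₀ hk0, one_mul, ← hMs]; exact hkM
      have hge2 : 1 ≤ (Real.sqrt (0 - t) / k) ^ 2 := one_le_pow₀ hge
      nlinarith [hsq, hge2]
  have hb : ‖fderiv ℝ (u ((k⁻¹) ^ 2 * t)) (k⁻¹ • x)‖ ≤ Gb := hann _ h2 h3 _ h1 h4
  -- assemble: `(k⁻¹)² ≤ 4c²/(|x| + √(−t))²` since `|x| + √(−t) ≤ 2M < 2kc`
  have hρ0 : 0 < ‖x‖ + Real.sqrt (0 - t) := by positivity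
  have hρk : (‖x‖ + Real.sqrt (0 - t)) / k ≤ 2 * c := by
    rw [div_le_iff₀ hk0]; nlinarith
  have key : (k⁻¹) ^ 2 ≤ 4 * c ^ 2 / (‖x‖ + Real.sqrt (0 - t)) ^ 2 := by
    rw [le_div_iff₀ (pow_pos hρ0 2)]
    have hsq' : (k⁻¹) ^ 2 * (‖x‖ + Real.sqrt (0 - t)) ^ 2 = ((‖x‖ + Real.sqrt (0 - t)) / k) ^ 2 := by
      rw [div_pow]; field_simp
    rw [hsq']
    have := pow_le_pow_left₀ (div_nonneg hρ0.le hk0.le) hρk 2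
    nlinarith [this]
  calc ‖fderiv ℝ (u t) x‖ = (k⁻¹) ^ 2 * ‖fderiv ℝ (u ((k⁻¹) ^ 2 * t)) (k⁻¹ • x)‖ := hgrad
    _ ≤ (k⁻¹) ^ 2 * Gb := mul_le_mul_of_nonneg_left hb (sq_nonneg _)
    _ ≤ 4 * c ^ 2 / (‖x‖ + Real.sqrt (0 - t)) ^ 2 * Gb := mul_le_mul_of_nonneg_right key hGb0
    _ = 4 * c ^ 2 * Gb / (‖x‖ + Real.sqrt (0 - t)) ^ 2 := by ring

/-- **The printed shape of Chae–Wolf's gradient estimate.**  `|∇u(t,x)| ≤ C₁/((−t) + |x|²)` (their (3.6) with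
`l = 1`) implies `|∇u(t,x)| ≤ 2·max(C₁,0)/(|x| + √(−t))²`, since `(|x| + √(−t))² ≤ 2((−t) + |x|²)`.
[cite: ChaeWolf2017RemovingDSS, §3 estimate (3.6) (arXiv:1610.09464 p. 8)] -/
theorem typeIGrad_of_sqForm {u : ℝ → (EuclideanSpace ℝ (Fin 3)) → (EuclideanSpace ℝ (Fin 3))} {C₁ : ℝ}
    (h : ∀ t : ℝ, t < 0 → ∀ x : EuclideanSpace ℝ (Fin 3),
      ‖fderiv ℝ (u t) x‖ ≤ C₁ / ((0 - t) + ‖x‖ ^ 2)) :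
    ∀ t : ℝ, t < 0 → ∀ x : EuclideanSpace ℝ (Fin 3),
      ‖fderiv ℝ (u t) x‖ ≤ (2 * max C₁ 0) / (‖x‖ + Real.sqrt (0 - t)) ^ 2 := by
  intro t ht x
  have ht' : (0 : ℝ) < 0 - t := by linarith
  have hst : 0 < Real.sqrt (0 - t) := Real.sqrt_pos.mpr ht'
  have hD : 0 < (0 - t) + ‖x‖ ^ 2 := by positivity
  have hρ : 0 < (‖x‖ + Real.sqrt (0 - t)) ^ 2 := by positivity
  have hcmp : (‖x‖ + Real.sqrt (0 - t)) ^ 2 ≤ 2 * ((0 - t) + ‖x‖ ^ 2) := by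
    nlinarith [Real.sq_sqrt ht'.le, sq_nonneg (‖x‖ - Real.sqrt (0 - t))]
  have hm : 0 ≤ max C₁ 0 := le_max_right _ _
  calc ‖fderiv ℝ (u t) x‖ ≤ C₁ / ((0 - t) + ‖x‖ ^ 2) := h t ht x
    _ ≤ max C₁ 0 / ((0 - t) + ‖x‖ ^ 2) := div_le_div_of_nonneg_right (le_max_left _ _) hD.le
    _ ≤ max C₁ 0 / ((‖x‖ + Real.sqrt (0 - t)) ^ 2 / 2) :=
        div_le_div_of_nonneg_left hm (by positivity) (by linarith)
    _ = (2 * max C₁ 0) / (‖x‖ + Real.sqrt (0 - t)) ^ 2 := by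
        rw [div_div_eq_mul_div]; ring

/-! ## §3 ROUND-54's velocity law with the Chae–Wolf hypothesis discharged -/

/-- A field with a non-zero curl somewhere is not identically zero there. [folklore] -/
theorem exists_ne_zero_of_curl_ne_zero {v : (EuclideanSpace ℝ (Fin 3)) → (EuclideanSpace ℝ (Fin 3))}
    {x : EuclideanSpace ℝ (Fin 3)} (hx : curl v x ≠ 0) : ∃ y : EuclideanSpace ℝ (Fin 3), v y ≠ 0 := by
  by_contra h
  push Not at h
  have hv : v = fun _ => (0 : EuclideanSpace ℝ (Fin 3)) := funext h
  apply hx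
  rw [curl_eq_curlCLM, hv, fderiv_const_apply, map_zero]

/-- ★★ **THE VELOCITY RECORD LAW ON CHAE–WOLF'S CLASS, HYPOTHESIS-FREE.**  Every `c`-DSS (`c > 1`) classical
solution `(u,p)` of the unforced Navier–Stokes equations (`ν = 1`) on `t < 0` with slices continuous into `L^q`,
`q ≥ 3`, and `u ≢ 0` has a point `(t,x)`, `t < 0`, `u(t,x) ≠ 0`, maximising `(0 − t)|u|²` over `(−∞,0) × ℝ³`, at
which `|u|(1 + 2(0 − t)|∇û|²_F) ≤ 2(0 − t)(−⟪û, ∇p⟫)` and `|u| ≤ 2(0 − t)|∇p|` — ROUND-54's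
`chaeWolf_dss_velocity_record_law` with the Chae–Wolf Type-I bound supplied by the tree's PROOF of their
Theorem 1.1 (`chaeWolf2017_dss_typeI_decay_holds`). [cite: ChaeWolf2017RemovingDSS, Theorem 1.1 (arXiv:1610.09464 p. 3)] -/
theorem chaeWolf_dss_velocity_record_law_holds {q : ℝ} (hq : 3 ≤ q) {c : ℝ} (hc : 1 < c)
    {u : ℝ → (EuclideanSpace ℝ (Fin 3)) → (EuclideanSpace ℝ (Fin 3))} {p : ℝ → (EuclideanSpace ℝ (Fin 3)) → ℝ}
    (hsol : IsClassicalNSSolutionOn (Iio 0) 1 0 u p)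
    (hLq : ∀ t < 0, MemLp (u t) (ENNReal.ofReal q) volume)
    (hcont : ∀ t₀ < 0, Filter.Tendsto (fun t => eLpNorm (u t - u t₀) (ENNReal.ofReal q) volume)
      (nhdsWithin t₀ (Iio 0)) (nhds 0))
    (hdss : IsDiscretelySelfSimilar c u)
    (hne : ∃ t₀ : ℝ, t₀ < 0 ∧ ∃ x₀ : EuclideanSpace ℝ (Fin 3), u t₀ x₀ ≠ 0) :
    ∃ t : ℝ, t < 0 ∧ ∃ x : EuclideanSpace ℝ (Fin 3), u t x ≠ 0 ∧
      (∀ s : ℝ, s < 0 → ∀ y : EuclideanSpace ℝ (Fin 3), (0 - s) * ‖u s y‖ ^ 2 ≤ (0 - t) * ‖u t x‖ ^ 2) ∧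
      ‖u t x‖ * (1 + 2 * (0 - t) * frobeniusNormSq (fderiv ℝ (vorticityDirection (u t)) x)) ≤
        2 * (0 - t) * (-⟪vorticityDirection (u t) x, gradient (p t) x⟫) ∧
      ‖u t x‖ ≤ 2 * (0 - t) * ‖gradient (p t) x‖ := by
  obtain ⟨t, ht, x, hux, hmax, hlaw, hVP⟩ :=
    chaeWolf_dss_velocity_record_law chaeWolf2017_dss_typeI_decay_holds hq hc hsol hLq hcont hdss hne
  refine ⟨t, ht, x, hux, hmax, ?_, hVP⟩
  simpa only [mul_one] using hlaw

/-! ## §4 The three numbers theorem -/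

/-- **The three numbers of a DSS singularity, from the period gradient decay.**  Core assembly: on Chae–Wolf's
class (`ν = 1`, `c`-DSS, `C((−∞,0);L^q)`, `q ≥ 3`) with `ω ≢ 0` and `∇u → 0` at spatial infinity uniformly on the
period `t ∈ [−c², −1]`, there are a strain record point, a vorticity record point and a velocity record point
carrying ROUND-52/53/54's laws, linked by `1 + (0 − t_ω)|∇ξ|²_F ≤ (0 − t_ω)q(t_ω,x_ω,ξ) ≤ N*`. [folklore] -/
theorem chaeWolf_dss_three_numbers_of_gradDecay {q : ℝ} (hq : 3 ≤ q) {c : ℝ} (hc : 1 < c)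
    {u : ℝ → (EuclideanSpace ℝ (Fin 3)) → (EuclideanSpace ℝ (Fin 3))} {p : ℝ → (EuclideanSpace ℝ (Fin 3)) → ℝ}
    (hsol : IsClassicalNSSolutionOn (Iio 0) 1 0 u p)
    (hLq : ∀ t < 0, MemLp (u t) (ENNReal.ofReal q) volume)
    (hcont : ∀ t₀ < 0, Filter.Tendsto (fun t => eLpNorm (u t - u t₀) (ENNReal.ofReal q) volume)
      (nhdsWithin t₀ (Iio 0)) (nhds 0))
    (hdss : IsDiscretelySelfSimilar c u)
    (hdecay : ∀ ε : ℝ, 0 < ε → ∃ R : ℝ, ∀ t ∈ Icc (-(c ^ 2)) (-1), ∀ x : EuclideanSpace ℝ (Fin 3),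
      R ≤ ‖x‖ → ‖fderiv ℝ (u t) x‖ ≤ ε)
    (hcurl : ∃ t₀ : ℝ, t₀ < 0 ∧ ∃ x₀ : EuclideanSpace ℝ (Fin 3), curl (u t₀) x₀ ≠ 0) :
    ∃ t : ℝ, t < 0 ∧ ∃ x e : EuclideanSpace ℝ (Fin 3), ‖e‖ = 1 ∧
      (∀ s : ℝ, s < 0 → ∀ y e' : EuclideanSpace ℝ (Fin 3), ‖e'‖ = 1 →
        (0 - s) * strainQuad u s y e' ≤ (0 - t) * strainQuad u t x e) ∧
      1 ≤ (0 - t) * strainQuad u t x e ∧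
      (0 - t) * strainQuad u t x e + ((0 - t) * strainQuad u t x e) ^ 2
          - (0 - t) ^ 2 * strainLap u t x e ≤ (0 - t) ^ 2 * strainFeed u p t x e ∧
      ∃ tω : ℝ, tω < 0 ∧ ∃ xω : EuclideanSpace ℝ (Fin 3), curl (u tω) xω ≠ 0 ∧
        (∀ s : ℝ, s < 0 → ∀ y : EuclideanSpace ℝ (Fin 3),
          (0 - s) * ‖curl (u s) y‖ ≤ (0 - tω) * ‖curl (u tω) xω‖) ∧
        1 + (0 - tω) * frobeniusNormSq (fderiv ℝ (vorticityDirection (curl (u tω))) xω) ≤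
          (0 - tω) * strainQuad u tω xω (vorticityDirection (curl (u tω)) xω) ∧
        (0 - tω) * strainQuad u tω xω (vorticityDirection (curl (u tω)) xω) ≤ (0 - t) * strainQuad u t x e ∧
        ∃ tv : ℝ, tv < 0 ∧ ∃ xv : EuclideanSpace ℝ (Fin 3), u tv xv ≠ 0 ∧
          (∀ s : ℝ, s < 0 → ∀ y : EuclideanSpace ℝ (Fin 3),
            (0 - s) * ‖u s y‖ ^ 2 ≤ (0 - tv) * ‖u tv xv‖ ^ 2) ∧
          ‖u tv xv‖ * (1 + 2 * (0 - tv) * frobeniusNormSq (fderiv ℝ (vorticityDirection (u tv)) xv)) ≤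
            2 * (0 - tv) * (-⟪vorticityDirection (u tv) xv, gradient (p tv) xv⟫) ∧
          ‖u tv xv‖ ≤ 2 * (0 - tv) * ‖gradient (p tv) xv‖ := by
  have hν : (0 : ℝ) ≤ 1 := zero_le_one
  -- the vorticity record point and its law
  obtain ⟨tω, htω, xω, hneω, hsupω, -, hξ, hflω⟩ := dss_vorticity_record_law hν hc hsol hdss hdecay hcurl
  have hFω : 0 ≤ frobeniusNormSq (fderiv ℝ (vorticityDirection (curl (u tω))) xω) := frobeniusNormSq_nonneg _
  have hfl' : 1 + (0 - tω) * frobeniusNormSq (fderiv ℝ (vorticityDirection (curl (u tω))) xω) ≤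
      (0 - tω) * strainQuad u tω xω (vorticityDirection (curl (u tω)) xω) := by
    simpa only [one_mul] using hflω
  have htω0 : 0 ≤ 0 - tω := by linarith
  have hprod : 0 ≤ (0 - tω) * frobeniusNormSq (fderiv ℝ (vorticityDirection (curl (u tω))) xω) :=
    mul_nonneg htω0 hFω
  have hqω : 0 < strainQuad u tω xω (vorticityDirection (curl (u tω)) xω) := by
    by_contra hq0
    push Not at hq0
    have : (0 - tω) * strainQuad u tω xω (vorticityDirection (curl (u tω)) xω) ≤ 0 :=
      mul_nonpos_of_nonneg_of_nonpos htω0 hq0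
    linarith
  -- the strain record point and its law (positivity witnessed at the vorticity record)
  obtain ⟨t, ht, x, e, he, -, hsup, -, hlaw, -⟩ :=
    dss_strain_record_law hν hc hsol hdss hdecay ⟨tω, htω, xω, _, hξ, hqω⟩
  have hlink : (0 - tω) * strainQuad u tω xω (vorticityDirection (curl (u tω)) xω) ≤
      (0 - t) * strainQuad u t x e := hsup tω htω xω _ hξ
  have hone : 1 ≤ (0 - t) * strainQuad u t x e := by linarith
  have hlaw' : (0 - t) * strainQuad u t x e + ((0 - t) * strainQuad u t x e) ^ 2
      - (0 - t) ^ 2 * strainLap u t x e ≤ (0 - t) ^ 2 * strainFeed u p t x e := by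
    simpa only [one_mul] using hlaw
  -- the velocity record point and its law (`u ≢ 0` because `ω ≢ 0`)
  obtain ⟨t₀, ht₀, x₀, hx₀⟩ := hcurl
  obtain ⟨y₀, hy₀⟩ := exists_ne_zero_of_curl_ne_zero hx₀
  obtain ⟨tv, htv, xv, hnev, hsupv, hlawv, hVP⟩ :=
    chaeWolf_dss_velocity_record_law_holds hq hc hsol hLq hcont hdss ⟨t₀, ht₀, y₀, hy₀⟩
  exact ⟨t, ht, x, e, he, hsup, hone, hlaw', tω, htω, xω, hneω, hsupω, hfl', hlink,
    tv, htv, xv, hnev, hsupv, hlawv, hVP⟩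

/-- ★★ **THE THREE NUMBERS OF A CHAE–WOLF DSS SINGULARITY.**  Let `(u,p)` be a classical solution of the
unforced Navier–Stokes equations (`ν = 1`) on `t < 0`, `c`-discretely self-similar (`c > 1`), with slices
continuous into `L^q(ℝ³)`, `q ≥ 3`, and `ω ≢ 0`; assume the SHELL GRADIENT BOUND
`sup {|∇u(t,x)| : −1 < t < 0, 1 ≤ |x| ≤ c} < ∞` (Chae–Wolf (3.6), `l = 1`: the gradient form of "regular off the
origin").  Then:
(N) at some `(t,x,e)`, `t < 0`, `|e| = 1`, maximising the strain number `(0 − s)q(s,y,e')` over all of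
`(−∞,0) × ℝ³ × S²`: `N* := (0 − t)q(t,x,e) ≥ 1` and `N* + N*² − (0 − t)²·strainLap ≤ (0 − t)²·H`;
(W) at some `(t_ω,x_ω)`, `t_ω < 0`, `ω ≠ 0`, maximising `(0 − s)|ω(s,y)|`: `1 + (0 − t_ω)|∇ξ|²_F ≤
(0 − t_ω)q(t_ω,x_ω,ξ) ≤ N*`;
(V) at some `(t_v,x_v)`, `t_v < 0`, `u ≠ 0`, maximising `(0 − s)|u(s,y)|²`: `|u|(1 + 2(0 − t_v)|∇û|²_F) ≤
2(0 − t_v)(−û·∇p)` and `|u| ≤ 2(0 − t_v)|∇p|`.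
The Chae–Wolf Type-I velocity bound is used BY NAME through the tree's proof `chaeWolf2017_dss_typeI_decay_holds`.
[cite: ChaeWolf2017RemovingDSS, Theorem 1.1 and §3 (3.6) (arXiv:1610.09464 p. 3, 7, 8); BradshawTsai2017, §5 (OP 5.1)] -/
theorem chaeWolf_dss_three_numbers {q : ℝ} (hq : 3 ≤ q) {c : ℝ} (hc : 1 < c)
    {u : ℝ → (EuclideanSpace ℝ (Fin 3)) → (EuclideanSpace ℝ (Fin 3))} {p : ℝ → (EuclideanSpace ℝ (Fin 3)) → ℝ}
    (hsol : IsClassicalNSSolutionOn (Iio 0) 1 0 u p)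
    (hLq : ∀ t < 0, MemLp (u t) (ENNReal.ofReal q) volume)
    (hcont : ∀ t₀ < 0, Filter.Tendsto (fun t => eLpNorm (u t - u t₀) (ENNReal.ofReal q) volume)
      (nhdsWithin t₀ (Iio 0)) (nhds 0))
    (hdss : IsDiscretelySelfSimilar c u)
    (hshell : ∃ G : ℝ, ∀ t : ℝ, -1 < t → t < 0 → ∀ x : EuclideanSpace ℝ (Fin 3),
      1 ≤ ‖x‖ → ‖x‖ ≤ c → ‖fderiv ℝ (u t) x‖ ≤ G)
    (hcurl : ∃ t₀ : ℝ, t₀ < 0 ∧ ∃ x₀ : EuclideanSpace ℝ (Fin 3), curl (u t₀) x₀ ≠ 0) :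
    ∃ t : ℝ, t < 0 ∧ ∃ x e : EuclideanSpace ℝ (Fin 3), ‖e‖ = 1 ∧
      (∀ s : ℝ, s < 0 → ∀ y e' : EuclideanSpace ℝ (Fin 3), ‖e'‖ = 1 →
        (0 - s) * strainQuad u s y e' ≤ (0 - t) * strainQuad u t x e) ∧
      1 ≤ (0 - t) * strainQuad u t x e ∧
      (0 - t) * strainQuad u t x e + ((0 - t) * strainQuad u t x e) ^ 2
          - (0 - t) ^ 2 * strainLap u t x e ≤ (0 - t) ^ 2 * strainFeed u p t x e ∧
      ∃ tω : ℝ, tω < 0 ∧ ∃ xω : EuclideanSpace ℝ (Fin 3), curl (u tω) xω ≠ 0 ∧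
        (∀ s : ℝ, s < 0 → ∀ y : EuclideanSpace ℝ (Fin 3),
          (0 - s) * ‖curl (u s) y‖ ≤ (0 - tω) * ‖curl (u tω) xω‖) ∧
        1 + (0 - tω) * frobeniusNormSq (fderiv ℝ (vorticityDirection (curl (u tω))) xω) ≤
          (0 - tω) * strainQuad u tω xω (vorticityDirection (curl (u tω)) xω) ∧
        (0 - tω) * strainQuad u tω xω (vorticityDirection (curl (u tω)) xω) ≤ (0 - t) * strainQuad u t x e ∧
        ∃ tv : ℝ, tv < 0 ∧ ∃ xv : EuclideanSpace ℝ (Fin 3), u tv xv ≠ 0 ∧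
          (∀ s : ℝ, s < 0 → ∀ y : EuclideanSpace ℝ (Fin 3),
            (0 - s) * ‖u s y‖ ^ 2 ≤ (0 - tv) * ‖u tv xv‖ ^ 2) ∧
          ‖u tv xv‖ * (1 + 2 * (0 - tv) * frobeniusNormSq (fderiv ℝ (vorticityDirection (u tv)) xv)) ≤
            2 * (0 - tv) * (-⟪vorticityDirection (u tv) xv, gradient (p tv) xv⟫) ∧
          ‖u tv xv‖ ≤ 2 * (0 - tv) * ‖gradient (p tv) xv‖ := by
  obtain ⟨C, hC⟩ := dss_typeIGrad_of_shell_bound hc hsol.smooth_velocity hdss hshell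
  exact chaeWolf_dss_three_numbers_of_gradDecay hq hc hsol hLq hcont hdss
    (periodGradDecay_of_typeI_grad (c := c) hC) hcurl

/-- ★★ **The three numbers theorem from the printed gradient estimate.**  Same conclusion with the shell bound
replaced by Chae–Wolf's (3.6), `l = 1`: `|∇u(t,x)| ≤ C₁/((−t) + |x|²)` for all `t < 0`, `x`.
[cite: ChaeWolf2017RemovingDSS, §3 estimate (3.6) (arXiv:1610.09464 p. 8)] -/
theorem chaeWolf_dss_three_numbers_of_typeIGrad {q : ℝ} (hq : 3 ≤ q) {c : ℝ} (hc : 1 < c)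
    {u : ℝ → (EuclideanSpace ℝ (Fin 3)) → (EuclideanSpace ℝ (Fin 3))} {p : ℝ → (EuclideanSpace ℝ (Fin 3)) → ℝ}
    (hsol : IsClassicalNSSolutionOn (Iio 0) 1 0 u p)
    (hLq : ∀ t < 0, MemLp (u t) (ENNReal.ofReal q) volume)
    (hcont : ∀ t₀ < 0, Filter.Tendsto (fun t => eLpNorm (u t - u t₀) (ENNReal.ofReal q) volume)
      (nhdsWithin t₀ (Iio 0)) (nhds 0))
    (hdss : IsDiscretelySelfSimilar c u)
    (hgradCW : ∃ C₁ : ℝ, ∀ t : ℝ, t < 0 → ∀ x : EuclideanSpace ℝ (Fin 3),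
      ‖fderiv ℝ (u t) x‖ ≤ C₁ / ((0 - t) + ‖x‖ ^ 2))
    (hcurl : ∃ t₀ : ℝ, t₀ < 0 ∧ ∃ x₀ : EuclideanSpace ℝ (Fin 3), curl (u t₀) x₀ ≠ 0) :
    ∃ t : ℝ, t < 0 ∧ ∃ x e : EuclideanSpace ℝ (Fin 3), ‖e‖ = 1 ∧
      (∀ s : ℝ, s < 0 → ∀ y e' : EuclideanSpace ℝ (Fin 3), ‖e'‖ = 1 →
        (0 - s) * strainQuad u s y e' ≤ (0 - t) * strainQuad u t x e) ∧
      1 ≤ (0 - t) * strainQuad u t x e ∧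
      (0 - t) * strainQuad u t x e + ((0 - t) * strainQuad u t x e) ^ 2
          - (0 - t) ^ 2 * strainLap u t x e ≤ (0 - t) ^ 2 * strainFeed u p t x e ∧
      ∃ tω : ℝ, tω < 0 ∧ ∃ xω : EuclideanSpace ℝ (Fin 3), curl (u tω) xω ≠ 0 ∧
        (∀ s : ℝ, s < 0 → ∀ y : EuclideanSpace ℝ (Fin 3),
          (0 - s) * ‖curl (u s) y‖ ≤ (0 - tω) * ‖curl (u tω) xω‖) ∧
        1 + (0 - tω) * frobeniusNormSq (fderiv ℝ (vorticityDirection (curl (u tω))) xω) ≤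
          (0 - tω) * strainQuad u tω xω (vorticityDirection (curl (u tω)) xω) ∧
        (0 - tω) * strainQuad u tω xω (vorticityDirection (curl (u tω)) xω) ≤ (0 - t) * strainQuad u t x e ∧
        ∃ tv : ℝ, tv < 0 ∧ ∃ xv : EuclideanSpace ℝ (Fin 3), u tv xv ≠ 0 ∧
          (∀ s : ℝ, s < 0 → ∀ y : EuclideanSpace ℝ (Fin 3),
            (0 - s) * ‖u s y‖ ^ 2 ≤ (0 - tv) * ‖u tv xv‖ ^ 2) ∧
          ‖u tv xv‖ * (1 + 2 * (0 - tv) * frobeniusNormSq (fderiv ℝ (vorticityDirection (u tv)) xv)) ≤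
            2 * (0 - tv) * (-⟪vorticityDirection (u tv) xv, gradient (p tv) xv⟫) ∧
          ‖u tv xv‖ ≤ 2 * (0 - tv) * ‖gradient (p tv) xv‖ := by
  obtain ⟨C₁, hC₁⟩ := hgradCW
  exact chaeWolf_dss_three_numbers_of_gradDecay hq hc hsol hLq hcont hdss
    (periodGradDecay_of_typeI_grad (c := c) (typeIGrad_of_sqForm hC₁)) hcurl

end Summit.NavierStokesRegularity.NavierStokesRegularity.Theorems.StrainDoors

end
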